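import Summits.QuantumFields.YangMills.Theorems.BalabanUVNodesN06L3131HLegAtPinsPhysPU
import Summits.QuantumFields.YangMills.Theorems.BalabanUVNodesN06WELegAtPinsPhysPUB
import Literature.MathematicalPhysics.QuantumFieldTheory.Balaban1983to89.B9SmoothHolderClassStateProducers
import Literature.MathematicalPhysics.QuantumFieldTheory.Balaban1983to89.B9SmoothHolderClassStateDominated
import Literature.MathematicalPhysics.QuantumFieldTheory.Balaban1983to89.B9Thm312WholeStepDirRegular
import Literature.MathematicalPhysics.QuantumFieldTheory.Balaban1983to89.B9Thm313WholeDelta2LettersAtStatePrint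
import Literature.MathematicalPhysics.QuantumFieldTheory.Balaban1983to89.B9Thm312WholeStepRegular
import Literature.MathematicalPhysics.QuantumFieldTheory.Balaban1983to89.B9MultiscaleSmoothPartitionYNear

import Literature.MathematicalPhysics.QuantumFieldTheory.Balaban1983to89.B9Thm312WholeStepDirRegular
import Literature.MathematicalPhysics.QuantumFieldTheory.Balaban1983to89.B9SmoothHolderClassPReadingsSite
import Literature.MathematicalPhysics.QuantumFieldTheory.Balaban1983to89.B9Thm312WholeStepDirFrom3131
import Literature.MathematicalPhysics.QuantumFieldTheory.Balaban1983to89.B9Thm313WholeHolder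
import Literature.MathematicalPhysics.QuantumFieldTheory.Balaban1983to89.B9LettersHZAtOne
/-!
# N06 [B9] — THE STEPS AND THE ONE-STEP PAIRS OVER THE STATE CLASSES AT THE PINS (U8 STEP 2c): `StepS` on 𝔖₂ ∕ 𝔖₁, and the left-form members `∇_UG₀T`, `∇_{U,ν}G₀T`,
# `Φ^Y_β∇_UG₀T`, `Φ^X_β∇_{U,ν}G₀T`, `Φ^X_βG₀T` (T = Δ′_π and Δ′_π + Δ⁽²⁾_π) OUT OF 𝔖₂ and 𝔖₁ — from the state letters (STEP 1), the producers (STEP 2a∕2b) and Theorem 3.3's members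

T. Bałaban, *Propagators for lattice gauge theories in a background field*, Commun. Math. Phys. **99** (1985) 389–434 [`Balaban1985BackgroundPropagators`, "B9"], Thm 3.12
p. 423 with (3.130)–(3.131) pp. 421–422, (3.137)–(3.138) p. 423, Thm 3.3 p. 399, (3.42)–(3.45) pp. 397–398, p. 398 (remark after (3.47)); [4] = T. Bałaban, *Propagators and
renormalization transformations for lattice gauge theories. II*, Commun. Math. Phys. **96** (1984) 223–250 [`Balaban1984PropagatorsII`], (2.54) p. 233, Lemma 2.1 (2.60)–(2.61) p. 234.

WHY (director-ym №272 (5) ∕ №285, FLAG №8 (U8); dag-n06-l P-U8S).  The repaired S-leaves take `hstate2 ∕ hstate1`: the steps `StepS 𝔬 𝔖 (θ_S·Mα₀) δ_K U` and the one-step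
left-form members out of the states (plus producers and readings, STEP 2a∕2b).  THIS FILE assembles them per member at `𝔖₂ := weightNorm (bXH x U) (rwt (−1))`, `𝔖₁ := bXH x U`:
the steps by dag-n06-l g26 `B9Thm312WholeStepRegular.stepS_of_lettersS` from the STATE LETTERS `LettersS3131 … 𝔖₂ (bH13 x U) (t_S·Mα₀) δ_S` (STEP 1, input `hLS`), the producers
`G₀ : 𝔠⁽⁰⁾ → 𝔖₂` (STEP 2b-A₀, input `hPG0`) and `G₀D_U : bH13 x U → 𝔖₂` (STEP 2b-A, input `hPGD`); the pairs by g27 `B9Thm312WholeStepDirRegular.stepDS∕stepDdS∕probeYS∕probeXdS∕probeXS_of_lettersS`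
from Theorem 3.3's members for G₀ (`he1 he1d h43L h43d` — the G₀ layer; `hpX0` — dag-n06-w6's zeroth probe) and the mixed members OUT OF `bH13 x U` (`hdgDH hdgDHd hYd hXd` — this
seat's Dg∕Yd∕Xd faces; `hpXDv` displayed at the W-sup class, moved to `bH13` by one power of `Lʲη` and the (P2′) sup reading `hasMaj_id_bHZPG_cNorm`); the 𝔖₁ versions by [4] (2.60)
(`stepS_up`, `fieldS_up`: one factor `L`, rate `−τ`).  All constants EXPLICIT (`κ_H ≤ 1 + C_Lip` from `hκ13`), rates: `ρ` on 𝔖₂, `ρ − τ` on 𝔖₁.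
★★★ `hStatePairs_of_pinsP_geo9Y`.
HONEST LABEL: helper toward the U8 re-leaf; every member enters as a HYPOTHESIS of printed species or a landed face output; count-neutral; N06 NOT discharged; K1⁹ NOT closed;
nothing continuum ∕ OS ∕ mass gap ∕ Clay.  Cell `pub-ymgap` (HUMAN RULING D-0062), Track A node N06 [B9], seat `pub-ymgap-dag-n06-d` (g18), 2026-08-29.  NEW file; nothing landed is modified.
-/

noncomputable section

namespace Summit.QuantumFields.YangMills.BalabanUVNodes.N06StatePairsAtPinsPU

open Literature.MathematicalPhysics.QuantumFieldTheory.Balaban1983to89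
open Literature.MathematicalPhysics.QuantumFieldTheory.Balaban1983to89.Node00 (FBondY IBondY SiteY CfgY SiteParY SiteOpY parSymY GpY GpPhysY BondOpY toKT)
open Literature.MathematicalPhysics.QuantumFieldTheory.Balaban1983to89.Node00.OpsYSectDCoords (DvcoKH DvscoKH TpicoK T2coK cR39_trBasis_pos)
open B9Thm39ReadingCoords (cR39)
open B9Thm34Ext (toB6)
open B11SectG (HasMaj BlockNorm RowSum)
open B9Thm312Whole (cNorm GeoOK)
open B9Thm312WholeClasses (cNormR rwt rwt_nonneg cNormR_κ)
open B9RWSums343to347Whole (Facts347)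
open B9CoReadingCoords (XBK blkBK)
open B9CoReadingCoordsS (XSK sIK blkSK GcoS)
open B9CoReadingCoordsH (XHK)
open B9CoReadingCoordsTranspose (TrIdx trBasis)
open B9PinMembersKLevelV1 (MemberY geo9Y)
open B9BackgroundsKLevelV1R (RegFamY bg9YR MemOfFam)
open B9GeoLemma21KLevelV1 (geo9Y_len_pos geo9Y_dist_triangle geo9Y_dist_comm rowSum261_geo9Y)
open B9GeoNormsKLevelV1 (geo9K geo9K_dist_nonneg)
open B7Prop2SpecialUnitary (specialUnitaryUnits)
open B9PerturbationMajorantAlgebra (Proj349Maj Thm31GpMaj hasMaj_weaken)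
open B9PerturbationMajorantsAtLetters (PcoK)
open B9MultiscaleSmoothPartitionYNear (rNear dist_sIK_le_of_nearY)
open B9SmoothHolderClassP (bHZKP bHZKPG bHZPG)
open B9GradViaDivLettersTransported (taxiB taxiS)
open B9PerturbationSplitAtLetters (TaLcoK TbLcoKH Ta2LcoK Tb2LcoKH tpi_t2_splitL_of_pins)
open B9PerturbationL2Delta2 (D2coK)
open B9SmoothHolderClassPProducers (CTel CTel_nonneg CTel_mono CTel_mul)
open B9SmoothHolderClassTClosure (abs_cf_eq_nKT)
open B9RWSums347DefiniteFaces (geo9Y_scalars exp261 facts347_exp261_geo9Y)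
open B9RowSum261DefiniteFaces (rowConst261 rowConst261_nonneg rowConst261_spec_of_rowSum261)
open B9SectDSup (weightNorm)
open B6RandomWalk (HasMajorant)
open B9Thm312WholeStepRegular (LettersS3131)
open B9Thm313WholeDelta2LettersAtStatePrint (ta2S_pins_print_of_h44G tb₂HS_pins_print_of_h43 hasMaj_state_of_raw_two)
open Summit.QuantumFields.YangMills.BalabanUVNodes.N06HolderPinsGradedAtRecord (links_le_one)
open B6Prop22KLevelTorusCensusEta (nKT)
open B6GlobalChartV1 (PV blkV1) open B6Ineq2142KLevelV1 (β lvl) open B6Geom246MultiLevelTorus (geomT)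
open scoped Matrix.Norms.L2Operator

open B9SmoothHolderClassState (hasMaj_id_state)
open B9SmoothHolderClassStateProducers (hasMaj_into_state_of_sup_probes)
open B9SmoothHolderClassStateDominated (exists_state_loc_le_sum)
open B9Thm312WholeStepDirRegular (readS_up)
open B9SectDSup (weightNorm_κ weightNorm_loc)
open B9CoReadingCoordsHolder (PK blkPK probeK wK w₀K)
open B9CoReadingCoordsHolderAdm (wKA holderProbesKA)
open B9RWSums343Holder (HolderProbes)
open B9MultiscaleSmoothPartitionYLip (CLip)
open Summit.QuantumFields.YangMills.BalabanUVNodes.N06WELegAtPinsPhysPUB (hκX_of_pinsP)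
open Literature.MathematicalPhysics.QuantumFieldTheory.Balaban1983to89.Node00 (parBY BondParY)

open B9Thm312WholeStepRegular (StepS stepS_of_lettersS)
open B9Thm312WholeStepDirRegular (stepDS_of_lettersS stepDdS_of_lettersS probeYS_of_lettersS probeXdS_of_lettersS probeXS_of_lettersS stepS_up fieldS_up)
open B9PerturbationMajorantAlgebra (hasMaj_shift rpow_abs_eq_pow)
open B9MultiscaleSmoothPartitionYLip (CLip_nonneg)
open B9SmoothHolderClassPReadingsSite (hasMaj_id_bHZPG_cNorm)
open B9Thm312WholeClasses (hasMaj_cNormR_of_hasMajorantHom)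
open B9Thm312WholeStepDirFrom3131 (hasMaj_probe_cNormR_of_hom)
open B9Thm313WholeHolder (hasMaj_toR_tgt)
open B9SmoothHolderClassState (hasMaj_rescale hasMaj_congr_src)
open B9LettersHZAtOne (plateau_pos)
open B11SectG (hasMaj_comp_exp)
open B9Thm312Whole (cNorm_κ)
open B6RandomWalkHom (HasMajorantHom hasMajorantHom_mono)
open B9CoReadingCoordsH (blkHK)

variable {N : ℕ} {d ℓ : ℕ} {hd : 1 ≤ d + 1} {hL : Odd (ℓ + 1) ∧ 1 < ℓ + 1} {b₀ b₁ : ℝ} {Mstar : ℕ}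

set_option maxHeartbeats 800000 in
/-- ★★★ **THE STEPS AND THE ONE-STEP PAIRS OVER 𝔖₂ AND 𝔖₁ AT THE PINS** (module docstring), member-uniformly in `x`, for `M ≥ M_T`, `Mα₀ ≤ a₀`, U ∈ (3.35)–(3.36).
[cite: Balaban1985BackgroundPropagators, Thm 3.12 p.423, (3.130)–(3.131) pp.421–422, (3.137)–(3.138) p.423, Thm 3.3 p.399, (3.42)–(3.45) pp.397–398, p.398 (remark after (3.47));
Balaban1984PropagatorsII, (2.54) p.233, Lemma 2.1 (2.60)–(2.61) p.234] -/
theorem hStatePairs_of_pinsP_geo9Y [NeZero N] [∀ x : MemberY d ℓ hd hL b₀ b₁ Mstar, Fintype (geo9Y x).Site]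
    {R₁ R₂ : RegFamY d ℓ hd hL b₀ b₁ Mstar (Matrix (Fin N) (Fin N) ℂ)} (H : MemberY d ℓ hd hL b₀ b₁ Mstar → Prop)
    (bI : ∀ x : MemberY d ℓ hd hL b₀ b₁ Mstar, FBondY x.toKIdx → IBondY x.toKIdx)
    (hlev : ∀ (x : MemberY d ℓ hd hL b₀ b₁ Mstar) (f : FBondY x.toKIdx), lvl x.hN x.D x.hk (bI x f) = (blkV1 x.hN x.D f).1.1)
    (hβ1 : ∀ (x : MemberY d ℓ hd hL b₀ b₁ Mstar) (f : FBondY x.toKIdx), (geomT x.D).dist (β x.hN x.D x.hk (bI x f)) (blkV1 x.hN x.D f) ≤ 1)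
    (c : ℝ) {M₀ a₀ : ℝ} (hM₀ : 0 ≤ M₀) {σ τ : ℝ} (hσ : 0 < σ) (hτ : 0 < τ)
    (w13 : ℝ → ℝ) (hw13₀ : ∀ s, 0 ≤ w13 s) (hw13₁ : ∀ s, w13 s ≤ 1)
    (bH13 : ∀ x : MemberY d ℓ hd hL b₀ b₁ Mstar, (bg9YR (Matrix (Fin N) (Fin N) ℂ) (specialUnitaryUnits (Fin N)) R₁ R₂ x).Cfg → BlockNorm (toB6 (geo9Y x) 1 (H x)) (XSK (TrIdx N) x.toKIdx → ℝ))
    (hbH13 : ∀ (x : MemberY d ℓ hd hL b₀ b₁ Mstar) (U : (bg9YR (Matrix (Fin N) (Fin N) ℂ) (specialUnitaryUnits (Fin N)) R₁ R₂ x).Cfg), bH13 x U =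
      letI : Fintype (geo9K x.toKIdx).Site := (inferInstance : Fintype (geo9Y x).Site);
      bHZPG (κ := TrIdx N) x.toKIdx (trBasis N) (taxiS x.toKIdx (bg9YR (Matrix (Fin N) (Fin N) ℂ) (specialUnitaryUnits (Fin N)) R₁ R₂ x) (fun U => U) U) (R := (1 : ℝ)) (H := H x) w13 hw13₀ hw13₁)
    (hκ13 : ∀ (x : MemberY d ℓ hd hL b₀ b₁ Mstar) (U : (bg9YR (Matrix (Fin N) (Fin N) ℂ) (specialUnitaryUnits (Fin N)) R₁ R₂ x).Cfg), (bH13 x U).κ ≤ 1 + CLip d ℓ)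
    (bXH : ∀ x : MemberY d ℓ hd hL b₀ b₁ Mstar, (bg9YR (Matrix (Fin N) (Fin N) ℂ) (specialUnitaryUnits (Fin N)) R₁ R₂ x).Cfg → BlockNorm (toB6 (geo9Y x) 1 (H x)) (XBK (TrIdx N) x.toKIdx → ℝ))
    {s44 : ℝ} (hs440 : 0 < s44) (hs441 : s44 < 1) (hw1344 : 0 < w13 s44)
    (𝔬12 : ∀ x : MemberY d ℓ hd hL b₀ b₁ Mstar, B9Thm312Whole.Ops (geo9Y x) (bg9YR (Matrix (Fin N) (Fin N) ℂ) (specialUnitaryUnits (Fin N)) R₁ R₂ x) (XBK (TrIdx N) x.toKIdx) (XBK (TrIdx N) x.toKIdx) (XHK (TrIdx N) x.toKIdx) (XSK (TrIdx N) x.toKIdx))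
    (hblkW12 : ∀ x : MemberY d ℓ hd hL b₀ b₁ Mstar, (𝔬12 x).blkW = blkSK x.toKIdx (sIK x.toKIdx (bI x)))
    {PX PY : MemberY d ℓ hd hL b₀ b₁ Mstar → Type} [∀ x, Fintype (PX x)] [∀ x, Fintype (PY x)]
    (𝔭A : ∀ x : MemberY d ℓ hd hL b₀ b₁ Mstar, HolderProbes (geo9Y x) (bg9YR (Matrix (Fin N) (Fin N) ℂ) (specialUnitaryUnits (Fin N)) R₁ R₂ x) (XBK (TrIdx N) x.toKIdx) (XBK (TrIdx N) x.toKIdx) (PX x) (PY x))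
    (Dd : ∀ x : MemberY d ℓ hd hL b₀ b₁ Mstar, (bg9YR (Matrix (Fin N) (Fin N) ℂ) (specialUnitaryUnits (Fin N)) R₁ R₂ x).Cfg → Fin (d + 1) → Module.End ℝ (XBK (TrIdx N) x.toKIdx → ℝ))
    -- the state letters' free letters (STEP 1 instantiates them with the coordinate split letters)
    (Ta Ta₂ : ∀ x : MemberY d ℓ hd hL b₀ b₁ Mstar, (bg9YR (Matrix (Fin N) (Fin N) ℂ) (specialUnitaryUnits (Fin N)) R₁ R₂ x).Cfg → Module.End ℝ (XBK (TrIdx N) x.toKIdx → ℝ))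
    (Tb Tb₂ : ∀ x : MemberY d ℓ hd hL b₀ b₁ Mstar, (bg9YR (Matrix (Fin N) (Fin N) ℂ) (specialUnitaryUnits (Fin N)) R₁ R₂ x).Cfg → (XBK (TrIdx N) x.toKIdx → ℝ) →ₗ[ℝ] (XSK (TrIdx N) x.toKIdx → ℝ))
    -- numerics
    {tS δS A₀ AW' δP B12₀ δ12₀ B₃ δ₃ cX0 δ12₃ ρ : ℝ} {Bh12 BhD BdX Bx13 : ℝ → ℝ}
    (htS : 0 ≤ tS) (hA₀ : 0 ≤ A₀) (hAW : 0 ≤ AW') (hB12₀ : 0 ≤ B12₀) (hB₃ : 0 ≤ B₃) (hcX0 : 0 ≤ cX0)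
    (hBh12 : ∀ β, 0 ≤ β → β < 1 → 0 ≤ Bh12 β) (hBhD : ∀ β, 0 ≤ β → β < 1 → 0 ≤ BhD β) (hBdX : ∀ β, 0 ≤ β → β < 1 → 0 ≤ BdX β) (hBx13 : ∀ β, 0 ≤ β → β < 1 → 0 ≤ Bx13 β)
    (hρ : 0 ≤ ρ) (hρT : ρ ≤ δS) (hρ0 : ρ + σ ≤ δ12₀) (hρ3 : ρ + σ ≤ δ₃) (hρP : ρ + σ ≤ δP) (hρX : ρ + 2 * σ + τ ≤ δ12₃)
    -- the inputs
    (hLS : ∀ x : MemberY d ℓ hd hL b₀ b₁ Mstar, M₀ ≤ (geo9Y x).M → ∀ α₀ : ℝ, 0 < α₀ → (geo9Y x).M * α₀ ≤ a₀ → ∀ U : (bg9YR (Matrix (Fin N) (Fin N) ℂ) (specialUnitaryUnits (Fin N)) R₁ R₂ x).Cfg, (bg9YR (Matrix (Fin N) (Fin N) ℂ) (specialUnitaryUnits (Fin N)) R₁ R₂ x).Reg335 c α₀ U → (bg9YR (Matrix (Fin N) (Fin N) ℂ) (specialUnitaryUnits (Fin N)) R₁ R₂ x).Reg336 c α₀ U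 →
      LettersS3131 (𝔬12 x) (Ta x) (Ta₂ x) (Tb x) (Tb₂ x) 1 (H x) (fun y => (geo9Y_len_pos x y).le) (weightNorm (bXH x U) (rwt (geo9Y x) (-1)) (rwt_nonneg (fun y => (geo9Y_len_pos x y).le) (-1))) (bH13 x U) (tS * ((geo9Y x).M * α₀)) δS U)
    (hPG0 : ∀ x : MemberY d ℓ hd hL b₀ b₁ Mstar, M₀ ≤ (geo9Y x).M → ∀ α₀ : ℝ, 0 < α₀ → (geo9Y x).M * α₀ ≤ a₀ → ∀ U : (bg9YR (Matrix (Fin N) (Fin N) ℂ) (specialUnitaryUnits (Fin N)) R₁ R₂ x).Cfg, (bg9YR (Matrix (Fin N) (Fin N) ℂ) (specialUnitaryUnits (Fin N)) R₁ R₂ x).Reg335 c α₀ U → (bg9YR (Matrix (Fin N) (Fin N) ℂ) (specialUnitaryUnits (Fin N)) R₁ R₂ x).Reg336 c α₀ U →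
      HasMaj (cNorm 1 (H x) (𝔬12 x).blk (fun y => (geo9Y_len_pos x y).le) 0) (weightNorm (bXH x U) (rwt (geo9Y x) (-1)) (rwt_nonneg (fun y => (geo9Y_len_pos x y).le) (-1))) ((𝔬12 x).G0 U) (fun a b => A₀ * Real.exp (-(δP * (geo9Y x).dist a b))))
    (hPGD : ∀ x : MemberY d ℓ hd hL b₀ b₁ Mstar, M₀ ≤ (geo9Y x).M → ∀ α₀ : ℝ, 0 < α₀ → (geo9Y x).M * α₀ ≤ a₀ → ∀ U : (bg9YR (Matrix (Fin N) (Fin N) ℂ) (specialUnitaryUnits (Fin N)) R₁ R₂ x).Cfg, (bg9YR (Matrix (Fin N) (Fin N) ℂ) (specialUnitaryUnits (Fin N)) R₁ R₂ x).Reg335 c α₀ U → (bg9YR (Matrix (Fin N) (Fin N) ℂ) (specialUnitaryUnits (Fin N)) R₁ R₂ x).Reg336 c α₀ U →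
      HasMaj (bH13 x U) (weightNorm (bXH x U) (rwt (geo9Y x) (-1)) (rwt_nonneg (fun y => (geo9Y_len_pos x y).le) (-1))) ((𝔬12 x).G0 U ∘ₗ (𝔬12 x).Dv U) (fun a b => AW' * Real.exp (-(δP * (geo9Y x).dist a b))))
    (he1 : ∀ x : MemberY d ℓ hd hL b₀ b₁ Mstar, M₀ ≤ (geo9Y x).M → ∀ α₀ : ℝ, 0 < α₀ → (geo9Y x).M * α₀ ≤ a₀ → ∀ U : (bg9YR (Matrix (Fin N) (Fin N) ℂ) (specialUnitaryUnits (Fin N)) R₁ R₂ x).Cfg, (bg9YR (Matrix (Fin N) (Fin N) ℂ) (specialUnitaryUnits (Fin N)) R₁ R₂ x).Reg335 c α₀ U → (bg9YR (Matrix (Fin N) (Fin N) ℂ) (specialUnitaryUnits (Fin N)) R₁ R₂ x).Reg336 c α₀ U →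
      HasMajorantHom (g := toB6 (geo9Y x) 1 (H x)) (𝔬12 x).blk (𝔬12 x).blkY ((𝔬12 x).D U ∘ₗ (𝔬12 x).G0 U) (fun (a b : (geo9Y x).Site) => B12₀ * (geo9Y x).len a * Real.exp (-(δ12₀ * (geo9Y x).dist a b))))
    (he1d : ∀ x : MemberY d ℓ hd hL b₀ b₁ Mstar, M₀ ≤ (geo9Y x).M → ∀ α₀ : ℝ, 0 < α₀ → (geo9Y x).M * α₀ ≤ a₀ → ∀ U : (bg9YR (Matrix (Fin N) (Fin N) ℂ) (specialUnitaryUnits (Fin N)) R₁ R₂ x).Cfg, (bg9YR (Matrix (Fin N) (Fin N) ℂ) (specialUnitaryUnits (Fin N)) R₁ R₂ x).Reg335 c α₀ U → (bg9YR (Matrix (Fin N) (Fin N) ℂ) (specialUnitaryUnits (Fin N)) R₁ R₂ x).Reg336 c α₀ U → ∀ ν : Fin (d + 1),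
      HasMajorantHom (g := toB6 (geo9Y x) 1 (H x)) (𝔬12 x).blk (𝔬12 x).blk (Dd x U ν ∘ₗ (𝔬12 x).G0 U) (fun (a b : (geo9Y x).Site) => B12₀ * (geo9Y x).len a * Real.exp (-(δ12₀ * (geo9Y x).dist a b))))
    (h43L : ∀ x : MemberY d ℓ hd hL b₀ b₁ Mstar, M₀ ≤ (geo9Y x).M → ∀ α₀ : ℝ, 0 < α₀ → (geo9Y x).M * α₀ ≤ a₀ → ∀ U : (bg9YR (Matrix (Fin N) (Fin N) ℂ) (specialUnitaryUnits (Fin N)) R₁ R₂ x).Cfg, (bg9YR (Matrix (Fin N) (Fin N) ℂ) (specialUnitaryUnits (Fin N)) R₁ R₂ x).Reg335 c α₀ U → (bg9YR (Matrix (Fin N) (Fin N) ℂ) (specialUnitaryUnits (Fin N)) R₁ R₂ x).Reg336 c α₀ U → ∀ β : ℝ, 0 ≤ β → β < 1 →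
      HasMajorantHom (g := toB6 (geo9Y x) 1 (H x)) (𝔬12 x).blk (𝔭A x).blkPY ((𝔭A x).ΦY U β ∘ₗ ((𝔬12 x).D U ∘ₗ (𝔬12 x).G0 U)) (fun (a b : (geo9Y x).Site) => Bh12 β * (geo9Y x).len a ^ (1 - β) * Real.exp (-(δ12₀ * (geo9Y x).dist a b))))
    (h43d : ∀ x : MemberY d ℓ hd hL b₀ b₁ Mstar, M₀ ≤ (geo9Y x).M → ∀ α₀ : ℝ, 0 < α₀ → (geo9Y x).M * α₀ ≤ a₀ → ∀ U : (bg9YR (Matrix (Fin N) (Fin N) ℂ) (specialUnitaryUnits (Fin N)) R₁ R₂ x).Cfg, (bg9YR (Matrix (Fin N) (Fin N) ℂ) (specialUnitaryUnits (Fin N)) R₁ R₂ x).Reg335 c α₀ U → (bg9YR (Matrix (Fin N) (Fin N) ℂ) (specialUnitaryUnits (Fin N)) R₁ R₂ x).Reg336 c α₀ U → ∀ (ν : Fin (d + 1)) (β : ℝ), 0 ≤ β → β < 1 →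
      HasMajorantHom (g := toB6 (geo9Y x) 1 (H x)) (𝔬12 x).blk (𝔭A x).blkPX ((𝔭A x).ΦX U β ∘ₗ (Dd x U ν ∘ₗ (𝔬12 x).G0 U)) (fun (a b : (geo9Y x).Site) => Bh12 β * (geo9Y x).len a ^ (1 - β) * Real.exp (-(δ12₀ * (geo9Y x).dist a b))))
    (hpX0 : ∀ x : MemberY d ℓ hd hL b₀ b₁ Mstar, M₀ ≤ (geo9Y x).M → ∀ α₀ : ℝ, 0 < α₀ → (geo9Y x).M * α₀ ≤ a₀ → ∀ U : (bg9YR (Matrix (Fin N) (Fin N) ℂ) (specialUnitaryUnits (Fin N)) R₁ R₂ x).Cfg, (bg9YR (Matrix (Fin N) (Fin N) ℂ) (specialUnitaryUnits (Fin N)) R₁ R₂ x).Reg335 c α₀ U → (bg9YR (Matrix (Fin N) (Fin N) ℂ) (specialUnitaryUnits (Fin N)) R₁ R₂ x).Reg336 c α₀ U → ∀ β : ℝ, 0 ≤ β → β < 1 →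
      HasMaj (cNormR 1 (H x) (𝔬12 x).blk (fun y => (geo9Y_len_pos x y).le) 0) (cNormR 1 (H x) (𝔭A x).blkPX (fun y => (geo9Y_len_pos x y).le) (β - 2)) ((𝔭A x).ΦX U β ∘ₗ (𝔬12 x).G0 U) (fun a b => cX0 * Real.exp (-(δ12₀ * (geo9Y x).dist a b))))
    (hdgDH : ∀ x : MemberY d ℓ hd hL b₀ b₁ Mstar, M₀ ≤ (geo9Y x).M → ∀ α₀ : ℝ, 0 < α₀ → (geo9Y x).M * α₀ ≤ a₀ → ∀ U : (bg9YR (Matrix (Fin N) (Fin N) ℂ) (specialUnitaryUnits (Fin N)) R₁ R₂ x).Cfg, (bg9YR (Matrix (Fin N) (Fin N) ℂ) (specialUnitaryUnits (Fin N)) R₁ R₂ x).Reg335 c α₀ U → (bg9YR (Matrix (Fin N) (Fin N) ℂ) (specialUnitaryUnits (Fin N)) R₁ R₂ x).Reg336 c α₀ U →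
      HasMaj (bH13 x U) (cNorm 1 (H x) (𝔬12 x).blkY (fun y => (geo9Y_len_pos x y).le) 1) ((𝔬12 x).D U ∘ₗ (𝔬12 x).G0 U ∘ₗ (𝔬12 x).Dv U) (fun a a' => B₃ * Real.exp (-(δ₃ * (geo9Y x).dist a a'))))
    (hdgDHd : ∀ x : MemberY d ℓ hd hL b₀ b₁ Mstar, M₀ ≤ (geo9Y x).M → ∀ α₀ : ℝ, 0 < α₀ → (geo9Y x).M * α₀ ≤ a₀ → ∀ U : (bg9YR (Matrix (Fin N) (Fin N) ℂ) (specialUnitaryUnits (Fin N)) R₁ R₂ x).Cfg, (bg9YR (Matrix (Fin N) (Fin N) ℂ) (specialUnitaryUnits (Fin N)) R₁ R₂ x).Reg335 c α₀ U → (bg9YR (Matrix (Fin N) (Fin N) ℂ) (specialUnitaryUnits (Fin N)) R₁ R₂ x).Reg336 c α₀ U → ∀ ν : Fin (d + 1),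
      HasMaj (bH13 x U) (cNorm 1 (H x) (𝔬12 x).blk (fun y => (geo9Y_len_pos x y).le) 1) (Dd x U ν ∘ₗ (𝔬12 x).G0 U ∘ₗ (𝔬12 x).Dv U) (fun a a' => B₃ * Real.exp (-(δ₃ * (geo9Y x).dist a a'))))
    (hYd : ∀ x : MemberY d ℓ hd hL b₀ b₁ Mstar, M₀ ≤ (geo9Y x).M → ∀ α₀ : ℝ, 0 < α₀ → (geo9Y x).M * α₀ ≤ a₀ → ∀ U : (bg9YR (Matrix (Fin N) (Fin N) ℂ) (specialUnitaryUnits (Fin N)) R₁ R₂ x).Cfg, (bg9YR (Matrix (Fin N) (Fin N) ℂ) (specialUnitaryUnits (Fin N)) R₁ R₂ x).Reg335 c α₀ U → (bg9YR (Matrix (Fin N) (Fin N) ℂ) (specialUnitaryUnits (Fin N)) R₁ R₂ x).Reg336 c α₀ U → ∀ β : ℝ, 0 ≤ β → β < 1 →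
      HasMaj (bH13 x U) (cNormR 1 (H x) (𝔭A x).blkPY (fun y => (geo9Y_len_pos x y).le) (β - 1)) (((𝔭A x).ΦY U β ∘ₗ (𝔬12 x).D U ∘ₗ (𝔬12 x).G0 U) ∘ₗ (𝔬12 x).Dv U) (fun a a' => BhD β * Real.exp (-(δ₃ * (geo9Y x).dist a a'))))
    (hXd : ∀ x : MemberY d ℓ hd hL b₀ b₁ Mstar, M₀ ≤ (geo9Y x).M → ∀ α₀ : ℝ, 0 < α₀ → (geo9Y x).M * α₀ ≤ a₀ → ∀ U : (bg9YR (Matrix (Fin N) (Fin N) ℂ) (specialUnitaryUnits (Fin N)) R₁ R₂ x).Cfg, (bg9YR (Matrix (Fin N) (Fin N) ℂ) (specialUnitaryUnits (Fin N)) R₁ R₂ x).Reg335 c α₀ U → (bg9YR (Matrix (Fin N) (Fin N) ℂ) (specialUnitaryUnits (Fin N)) R₁ R₂ x).Reg336 c α₀ U → ∀ (ν : Fin (d + 1)) (β : ℝ), 0 ≤ β → β < 1 →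
      HasMaj (bH13 x U) (cNormR 1 (H x) (𝔭A x).blkPX (fun y => (geo9Y_len_pos x y).le) (β - 1)) (((𝔭A x).ΦX U β ∘ₗ Dd x U ν ∘ₗ (𝔬12 x).G0 U) ∘ₗ (𝔬12 x).Dv U) (fun a a' => BdX β * Real.exp (-(δ₃ * (geo9Y x).dist a a'))))
    (hpXDv : ∀ x : MemberY d ℓ hd hL b₀ b₁ Mstar, M₀ ≤ (geo9Y x).M → ∀ α₀ : ℝ, 0 < α₀ → (geo9Y x).M * α₀ ≤ a₀ → ∀ U : (bg9YR (Matrix (Fin N) (Fin N) ℂ) (specialUnitaryUnits (Fin N)) R₁ R₂ x).Cfg, (bg9YR (Matrix (Fin N) (Fin N) ℂ) (specialUnitaryUnits (Fin N)) R₁ R₂ x).Reg335 c α₀ U → (bg9YR (Matrix (Fin N) (Fin N) ℂ) (specialUnitaryUnits (Fin N)) R₁ R₂ x).Reg336 c α₀ U → ∀ β : ℝ, 0 ≤ β → β < 1 →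
      HasMaj (cNormR 1 (H x) (𝔬12 x).blkW (fun y => (geo9Y_len_pos x y).le) 0) (cNormR 1 (H x) (𝔭A x).blkPX (fun y => (geo9Y_len_pos x y).le) (β - 1)) (((𝔭A x).ΦX U β ∘ₗ (𝔬12 x).G0 U) ∘ₗ (𝔬12 x).Dv U) (fun a b => Bx13 β * Real.exp (-(δ12₃ * (geo9Y x).dist a b)))) :
    ∃ MT : ℝ, ∀ x : MemberY d ℓ hd hL b₀ b₁ Mstar, MT ≤ (geo9Y x).M → ∀ α₀ : ℝ, 0 < α₀ → (geo9Y x).M * α₀ ≤ a₀ → ∀ U : (bg9YR (Matrix (Fin N) (Fin N) ℂ) (specialUnitaryUnits (Fin N)) R₁ R₂ x).Cfg, (bg9YR (Matrix (Fin N) (Fin N) ℂ) (specialUnitaryUnits (Fin N)) R₁ R₂ x).Reg335 c α₀ U → (bg9YR (Matrix (Fin N) (Fin N) ℂ) (specialUnitaryUnits (Fin N)) R₁ R₂ x).Reg336 c α₀ U →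
      -- the steps on 𝔖₂ (rate ρ) and 𝔖₁ (rate ρ − τ)
      StepS (𝔬12 x) (weightNorm (bXH x U) (rwt (geo9Y x) (-1)) (rwt_nonneg (fun y => (geo9Y_len_pos x y).le) (-1))) (2 * ((A₀ + (1 + CLip d ℓ) * AW') * tS * rowConst261 (@geo9Y d ℓ hd hL b₀ b₁ Mstar) σ) * ((geo9Y x).M * α₀)) ρ U ∧
      StepS (𝔬12 x) (bXH x U) (2 * ((A₀ + (1 + CLip d ℓ) * AW') * tS * rowConst261 (@geo9Y d ℓ hd hL b₀ b₁ Mstar) σ) * (((ℓ + 1 : ℕ) : ℝ)) * ((geo9Y x).M * α₀)) (ρ - τ) U ∧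
      -- ∇_UG₀T : 𝔖₂ → 𝔠_Y⁽¹⁾ (both T)
      (HasMaj (weightNorm (bXH x U) (rwt (geo9Y x) (-1)) (rwt_nonneg (fun y => (geo9Y_len_pos x y).le) (-1))) (cNorm 1 (H x) (𝔬12 x).blkY (fun y => (geo9Y_len_pos x y).le) 1) ((𝔬12 x).D U ∘ₗ (𝔬12 x).G0 U ∘ₗ (𝔬12 x).Tpi U) (fun a b => 2 * ((B12₀ + (1 + CLip d ℓ) * B₃) * tS * rowConst261 (@geo9Y d ℓ hd hL b₀ b₁ Mstar) σ) * ((geo9Y x).M * α₀) * Real.exp (-(ρ * (geo9Y x).dist a b))) ∧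
        HasMaj (weightNorm (bXH x U) (rwt (geo9Y x) (-1)) (rwt_nonneg (fun y => (geo9Y_len_pos x y).le) (-1))) (cNorm 1 (H x) (𝔬12 x).blkY (fun y => (geo9Y_len_pos x y).le) 1) ((𝔬12 x).D U ∘ₗ (𝔬12 x).G0 U ∘ₗ ((𝔬12 x).Tpi U + (𝔬12 x).T2 U)) (fun a b => 2 * ((B12₀ + (1 + CLip d ℓ) * B₃) * tS * rowConst261 (@geo9Y d ℓ hd hL b₀ b₁ Mstar) σ) * ((geo9Y x).M * α₀) * Real.exp (-(ρ * (geo9Y x).dist a b)))) ∧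
      -- ∇_{U,ν}G₀T : 𝔖₂ → 𝔠⁽¹⁾ and 𝔖₁ → 𝔠^{(0)} (both T)
      (∀ ν : Fin (d + 1),
        (HasMaj (weightNorm (bXH x U) (rwt (geo9Y x) (-1)) (rwt_nonneg (fun y => (geo9Y_len_pos x y).le) (-1))) (cNorm 1 (H x) (𝔬12 x).blk (fun y => (geo9Y_len_pos x y).le) 1) (Dd x U ν ∘ₗ (𝔬12 x).G0 U ∘ₗ (𝔬12 x).Tpi U) (fun a b => 2 * ((B12₀ + (1 + CLip d ℓ) * B₃) * tS * rowConst261 (@geo9Y d ℓ hd hL b₀ b₁ Mstar) σ) * ((geo9Y x).M * α₀) * Real.exp (-(ρ * (geo9Y x).dist a b))) ∧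
          HasMaj (weightNorm (bXH x U) (rwt (geo9Y x) (-1)) (rwt_nonneg (fun y => (geo9Y_len_pos x y).le) (-1))) (cNorm 1 (H x) (𝔬12 x).blk (fun y => (geo9Y_len_pos x y).le) 1) (Dd x U ν ∘ₗ (𝔬12 x).G0 U ∘ₗ ((𝔬12 x).Tpi U + (𝔬12 x).T2 U)) (fun a b => 2 * ((B12₀ + (1 + CLip d ℓ) * B₃) * tS * rowConst261 (@geo9Y d ℓ hd hL b₀ b₁ Mstar) σ) * ((geo9Y x).M * α₀) * Real.exp (-(ρ * (geo9Y x).dist a b)))) ∧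
        (HasMaj (bXH x U) (cNormR 1 (H x) (𝔬12 x).blk (fun y => (geo9Y_len_pos x y).le) 0) (Dd x U ν ∘ₗ (𝔬12 x).G0 U ∘ₗ (𝔬12 x).Tpi U) (fun a b => 2 * ((B12₀ + (1 + CLip d ℓ) * B₃) * tS * rowConst261 (@geo9Y d ℓ hd hL b₀ b₁ Mstar) σ) * ((geo9Y x).M * α₀) * (geo9Y x).L * Real.exp (-((ρ - τ) * (geo9Y x).dist a b))) ∧
          HasMaj (bXH x U) (cNormR 1 (H x) (𝔬12 x).blk (fun y => (geo9Y_len_pos x y).le) 0) (Dd x U ν ∘ₗ (𝔬12 x).G0 U ∘ₗ ((𝔬12 x).Tpi U + (𝔬12 x).T2 U)) (fun a b => 2 * ((B12₀ + (1 + CLip d ℓ) * B₃) * tS * rowConst261 (@geo9Y d ℓ hd hL b₀ b₁ Mstar) σ) * ((geo9Y x).M * α₀) * (geo9Y x).L * Real.exp (-((ρ - τ) * (geo9Y x).dist a b))))) ∧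
      -- Φ^Y_β∇_UG₀T : 𝔖₂ → 𝔠_PY^{(β−1)} (both T)
      (∀ β : ℝ, 0 ≤ β → β < 1 →
        HasMaj (weightNorm (bXH x U) (rwt (geo9Y x) (-1)) (rwt_nonneg (fun y => (geo9Y_len_pos x y).le) (-1))) (cNormR 1 (H x) (𝔭A x).blkPY (fun y => (geo9Y_len_pos x y).le) (β - 1)) (((𝔭A x).ΦY U β ∘ₗ (𝔬12 x).D U ∘ₗ (𝔬12 x).G0 U) ∘ₗ (𝔬12 x).Tpi U) (fun a b => 2 * ((Bh12 β + (1 + CLip d ℓ) * BhD β) * tS * rowConst261 (@geo9Y d ℓ hd hL b₀ b₁ Mstar) σ) * ((geo9Y x).M * α₀) * Real.exp (-(ρ * (geo9Y x).dist a b))) ∧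
        HasMaj (weightNorm (bXH x U) (rwt (geo9Y x) (-1)) (rwt_nonneg (fun y => (geo9Y_len_pos x y).le) (-1))) (cNormR 1 (H x) (𝔭A x).blkPY (fun y => (geo9Y_len_pos x y).le) (β - 1)) (((𝔭A x).ΦY U β ∘ₗ (𝔬12 x).D U ∘ₗ (𝔬12 x).G0 U) ∘ₗ ((𝔬12 x).Tpi U + (𝔬12 x).T2 U)) (fun a b => 2 * ((Bh12 β + (1 + CLip d ℓ) * BhD β) * tS * rowConst261 (@geo9Y d ℓ hd hL b₀ b₁ Mstar) σ) * ((geo9Y x).M * α₀) * Real.exp (-(ρ * (geo9Y x).dist a b)))) ∧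
      -- Φ^X_β∇_{U,ν}G₀T : 𝔖₂ → 𝔠_PX^{(β−1)} and 𝔖₁ → 𝔠_PX^{(β)} (both T)
      (∀ (ν : Fin (d + 1)) (β : ℝ), 0 ≤ β → β < 1 →
        (HasMaj (weightNorm (bXH x U) (rwt (geo9Y x) (-1)) (rwt_nonneg (fun y => (geo9Y_len_pos x y).le) (-1))) (cNormR 1 (H x) (𝔭A x).blkPX (fun y => (geo9Y_len_pos x y).le) (β - 1)) (((𝔭A x).ΦX U β ∘ₗ Dd x U ν ∘ₗ (𝔬12 x).G0 U) ∘ₗ (𝔬12 x).Tpi U) (fun a b => 2 * ((Bh12 β + (1 + CLip d ℓ) * BdX β) * tS * rowConst261 (@geo9Y d ℓ hd hL b₀ b₁ Mstar) σ) * ((geo9Y x).M * α₀) * Real.exp (-(ρ * (geo9Y x).dist a b))) ∧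
          HasMaj (weightNorm (bXH x U) (rwt (geo9Y x) (-1)) (rwt_nonneg (fun y => (geo9Y_len_pos x y).le) (-1))) (cNormR 1 (H x) (𝔭A x).blkPX (fun y => (geo9Y_len_pos x y).le) (β - 1)) (((𝔭A x).ΦX U β ∘ₗ Dd x U ν ∘ₗ (𝔬12 x).G0 U) ∘ₗ ((𝔬12 x).Tpi U + (𝔬12 x).T2 U)) (fun a b => 2 * ((Bh12 β + (1 + CLip d ℓ) * BdX β) * tS * rowConst261 (@geo9Y d ℓ hd hL b₀ b₁ Mstar) σ) * ((geo9Y x).M * α₀) * Real.exp (-(ρ * (geo9Y x).dist a b)))) ∧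
        (HasMaj (bXH x U) (cNormR 1 (H x) (𝔭A x).blkPX (fun y => (geo9Y_len_pos x y).le) β) (((𝔭A x).ΦX U β ∘ₗ Dd x U ν ∘ₗ (𝔬12 x).G0 U) ∘ₗ (𝔬12 x).Tpi U) (fun a b => 2 * ((Bh12 β + (1 + CLip d ℓ) * BdX β) * tS * rowConst261 (@geo9Y d ℓ hd hL b₀ b₁ Mstar) σ) * ((geo9Y x).M * α₀) * (geo9Y x).L * Real.exp (-((ρ - τ) * (geo9Y x).dist a b))) ∧
          HasMaj (bXH x U) (cNormR 1 (H x) (𝔭A x).blkPX (fun y => (geo9Y_len_pos x y).le) β) (((𝔭A x).ΦX U β ∘ₗ Dd x U ν ∘ₗ (𝔬12 x).G0 U) ∘ₗ ((𝔬12 x).Tpi U + (𝔬12 x).T2 U)) (fun a b => 2 * ((Bh12 β + (1 + CLip d ℓ) * BdX β) * tS * rowConst261 (@geo9Y d ℓ hd hL b₀ b₁ Mstar) σ) * ((geo9Y x).M * α₀) * (geo9Y x).L * Real.exp (-((ρ - τ) * (geo9Y x).dist a b))))) ∧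
      -- Φ^X_βG₀T : 𝔖₂ → 𝔠_PX^{(β−2)} and 𝔖₁ → 𝔠_PX^{(β−1)} (both T)
      (∀ β : ℝ, 0 ≤ β → β < 1 →
        (HasMaj (weightNorm (bXH x U) (rwt (geo9Y x) (-1)) (rwt_nonneg (fun y => (geo9Y_len_pos x y).le) (-1))) (cNormR 1 (H x) (𝔭A x).blkPX (fun y => (geo9Y_len_pos x y).le) (β - 2)) (((𝔭A x).ΦX U β ∘ₗ (𝔬12 x).G0 U) ∘ₗ (𝔬12 x).Tpi U) (fun a b => 2 * ((cX0 + (1 + CLip d ℓ) * (1 * (Bx13 β * (((ℓ + 1 : ℕ) : ℝ))) * ((w13 s44)⁻¹ * ((((ℓ + 1 : ℕ) : ℝ)) * Real.exp ((δ12₃ - τ) * (rNear d ℓ + 1)))) * rowConst261 (@geo9Y d ℓ hd hL b₀ b₁ Mstar) σ)) * tS * rowConst261 (@geo9Y d ℓ hd hL b₀ b₁ Mstar) σ) * ((geo9Y x).M * α₀) * Real.exp (-(ρ * (geo9Y x).dist a b))) ∧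
          HasMaj (weightNorm (bXH x U) (rwt (geo9Y x) (-1)) (rwt_nonneg (fun y => (geo9Y_len_pos x y).le) (-1))) (cNormR 1 (H x) (𝔭A x).blkPX (fun y => (geo9Y_len_pos x y).le) (β - 2)) (((𝔭A x).ΦX U β ∘ₗ (𝔬12 x).G0 U) ∘ₗ ((𝔬12 x).Tpi U + (𝔬12 x).T2 U)) (fun a b => 2 * ((cX0 + (1 + CLip d ℓ) * (1 * (Bx13 β * (((ℓ + 1 : ℕ) : ℝ))) * ((w13 s44)⁻¹ * ((((ℓ + 1 : ℕ) : ℝ)) * Real.exp ((δ12₃ - τ) * (rNear d ℓ + 1)))) * rowConst261 (@geo9Y d ℓ hd hL b₀ b₁ Mstar) σ)) * tS * rowConst261 (@geo9Y d ℓ hd hL b₀ b₁ Mstar) σ) * ((geo9Y x).M * α₀) * Real.exp (-(ρ * (geo9Y x).dist a b)))) ∧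
        (HasMaj (bXH x U) (cNormR 1 (H x) (𝔭A x).blkPX (fun y => (geo9Y_len_pos x y).le) (β - 1)) (((𝔭A x).ΦX U β ∘ₗ (𝔬12 x).G0 U) ∘ₗ (𝔬12 x).Tpi U) (fun a b => 2 * ((cX0 + (1 + CLip d ℓ) * (1 * (Bx13 β * (((ℓ + 1 : ℕ) : ℝ))) * ((w13 s44)⁻¹ * ((((ℓ + 1 : ℕ) : ℝ)) * Real.exp ((δ12₃ - τ) * (rNear d ℓ + 1)))) * rowConst261 (@geo9Y d ℓ hd hL b₀ b₁ Mstar) σ)) * tS * rowConst261 (@geo9Y d ℓ hd hL b₀ b₁ Mstar) σ) * ((geo9Y x).M * α₀) * (geo9Y x).L * Real.exp (-((ρ - τ) * (geo9Y x).dist a b))) ∧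
          HasMaj (bXH x U) (cNormR 1 (H x) (𝔭A x).blkPX (fun y => (geo9Y_len_pos x y).le) (β - 1)) (((𝔭A x).ΦX U β ∘ₗ (𝔬12 x).G0 U) ∘ₗ ((𝔬12 x).Tpi U + (𝔬12 x).T2 U)) (fun a b => 2 * ((cX0 + (1 + CLip d ℓ) * (1 * (Bx13 β * (((ℓ + 1 : ℕ) : ℝ))) * ((w13 s44)⁻¹ * ((((ℓ + 1 : ℕ) : ℝ)) * Real.exp ((δ12₃ - τ) * (rNear d ℓ + 1)))) * rowConst261 (@geo9Y d ℓ hd hL b₀ b₁ Mstar) σ)) * tS * rowConst261 (@geo9Y d ℓ hd hL b₀ b₁ Mstar) σ) * ((geo9Y x).M * α₀) * (geo9Y x).L * Real.exp (-((ρ - τ) * (geo9Y x).dist a b))))) := by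
  obtain ⟨Mg, hFa⟩ := facts347_exp261_geo9Y (d := d) (ℓ := ℓ) (hd := hd) (hL := hL) (b₀ := b₀) (b₁ := b₁) (Mstar := Mstar) H (α := 1 / 2) (δ := 2 * τ)
    (by norm_num) (by norm_num) (by linarith)
  obtain ⟨ML, hrow⟩ := rowConst261_spec_of_rowSum261 (rowSum261_geo9Y (d := d) (ℓ := ℓ) (hd := hd) (hL := hL) (b₀ := b₀) (b₁ := b₁) (Mstar := Mstar)) hσ
  have hc0 : (0 : ℝ) ≤ rowConst261 (@geo9Y d ℓ hd hL b₀ b₁ Mstar) σ := rowConst261_nonneg _ _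
  have hτe : (1 : ℝ) / 2 * (2 * τ) = τ := by ring
  refine ⟨max M₀ (max Mg ML), fun x hM α₀ hα ha U hU hU' => ?_⟩
  letI : Fintype (geo9K x.toKIdx).Site := (inferInstance : Fintype (geo9Y x).Site)
  have hM0 : M₀ ≤ (geo9Y x).M := (le_max_left _ _).trans hM
  have hFax := hFa x (((le_max_left _ _).trans (le_max_right _ _)).trans hM)
  have hrowx : RowSum (toB6 (geo9Y x) 1 (H x)) σ (rowConst261 (@geo9Y d ℓ hd hL b₀ b₁ Mstar) σ) := fun y => hrow x (((le_max_right _ _).trans (le_max_right _ _)).trans hM) y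
  have hG : GeoOK (geo9Y x) := ⟨geo9Y_dist_triangle x, geo9Y_dist_comm x, geo9K_dist_nonneg x.toKIdx, geo9Y_len_pos x⟩
  have htri : B6RandomWalk.Triangle254 (toB6 (geo9Y x) 1 (H x)) := fun a b e => hG.tri a b e
  have hcf := abs_cf_eq_nKT x.toKIdx x.hcfk
  have hNr : ∀ (y : IBondY x.toKIdx) (z : SiteY x.toKIdx), B9MultiscaleSmoothPartitionY.NearY x.toKIdx y z → (geo9K x.toKIdx).dist y (sIK x.toKIdx (bI x) z) ≤ rNear d ℓ + 1 :=
    fun y z h => dist_sIK_le_of_nearY x.toKIdx (hβ1 x) h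
  have hLx : (geo9Y x).L ≤ (((ℓ + 1 : ℕ) : ℝ)) := (geo9Y_scalars x).2.1
  have hL0 : 0 ≤ (geo9Y x).L := le_trans zero_le_one hFax.one_le_L
  have hθ : 0 ≤ ((geo9Y x).M * α₀) := mul_nonneg (hM₀.trans hM0) hα.le
  have ht : 0 ≤ tS * ((geo9Y x).M * α₀) := mul_nonneg htS hθ
  have hκ := hκ13 x U
  have hκ0 : 0 ≤ (bH13 x U).κ := (bH13 x U).κ_nonneg
  have hK1 : 0 ≤ (1 + CLip d ℓ) := add_nonneg zero_le_one (CLip_nonneg d ℓ)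
  have hLSx := hLS x hM0 α₀ hα ha U hU hU'
  -- the common shape of the θ-conditions: `2((a + κ_H·b)·(t_S·Mα₀)·c) ≤ 2((a + (1 + C_Lip)·b)·t_S·c)·Mα₀`
  have hθc : ∀ a b : ℝ, 0 ≤ a → 0 ≤ b → 2 * ((a + (bH13 x U).κ * b) * (tS * ((geo9Y x).M * α₀)) * rowConst261 (@geo9Y d ℓ hd hL b₀ b₁ Mstar) σ) ≤ 2 * ((a + (1 + CLip d ℓ) * b) * tS * rowConst261 (@geo9Y d ℓ hd hL b₀ b₁ Mstar) σ) * ((geo9Y x).M * α₀) := by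
    intro a b ha0 hb0
    have h1 : (a + (bH13 x U).κ * b) * (tS * ((geo9Y x).M * α₀)) * rowConst261 (@geo9Y d ℓ hd hL b₀ b₁ Mstar) σ ≤ (a + (1 + CLip d ℓ) * b) * (tS * ((geo9Y x).M * α₀)) * rowConst261 (@geo9Y d ℓ hd hL b₀ b₁ Mstar) σ :=
      mul_le_mul_of_nonneg_right (mul_le_mul_of_nonneg_right (by nlinarith [mul_le_mul_of_nonneg_right hκ hb0]) ht) hc0
    nlinarith [h1]
  -- (1) the step on 𝔖₂ from the state letters and the two producers; (2) on 𝔖₁ by [4] (2.60)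
  have hS2 : StepS (𝔬12 x) (weightNorm (bXH x U) (rwt (geo9Y x) (-1)) (rwt_nonneg (fun y => (geo9Y_len_pos x y).le) (-1))) (2 * ((A₀ + (1 + CLip d ℓ) * AW') * tS * rowConst261 (@geo9Y d ℓ hd hL b₀ b₁ Mstar) σ) * ((geo9Y x).M * α₀)) ρ U :=
    stepS_of_lettersS hG hrowx hc0 hA₀ hAW ht hρ hρT hρP hρP (hθc A₀ AW' hA₀ hAW) le_rfl (hPG0 x hM0 α₀ hα ha U hU hU') (hPGD x hM0 α₀ hα ha U hU hU') hLSx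
  have hθ20 : 0 ≤ 2 * ((A₀ + (1 + CLip d ℓ) * AW') * tS * rowConst261 (@geo9Y d ℓ hd hL b₀ b₁ Mstar) σ) * ((geo9Y x).M * α₀) := by positivity
  have hS1a := stepS_up hG hFax hθ20 hS2.step
  have hS1b := stepS_up hG hFax hθ20 hS2.step1
  rw [hτe] at hS1a hS1b
  have hkS : ∀ a b : (geo9Y x).Site, 2 * ((A₀ + (1 + CLip d ℓ) * AW') * tS * rowConst261 (@geo9Y d ℓ hd hL b₀ b₁ Mstar) σ) * ((geo9Y x).M * α₀) * (geo9Y x).L * Real.exp (-((ρ - τ) * (geo9Y x).dist a b)) ≤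
      2 * ((A₀ + (1 + CLip d ℓ) * AW') * tS * rowConst261 (@geo9Y d ℓ hd hL b₀ b₁ Mstar) σ) * (((ℓ + 1 : ℕ) : ℝ)) * ((geo9Y x).M * α₀) * Real.exp (-((ρ - τ) * (geo9Y x).dist a b)) := fun a b => by
    refine mul_le_mul_of_nonneg_right ?_ (Real.exp_nonneg _)
    calc 2 * ((A₀ + (1 + CLip d ℓ) * AW') * tS * rowConst261 (@geo9Y d ℓ hd hL b₀ b₁ Mstar) σ) * ((geo9Y x).M * α₀) * (geo9Y x).L ≤ 2 * ((A₀ + (1 + CLip d ℓ) * AW') * tS * rowConst261 (@geo9Y d ℓ hd hL b₀ b₁ Mstar) σ) * ((geo9Y x).M * α₀) * (((ℓ + 1 : ℕ) : ℝ)) := mul_le_mul_of_nonneg_left hLx hθ20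
      _ = _ := by ring
  have hS1 : StepS (𝔬12 x) (bXH x U) (2 * ((A₀ + (1 + CLip d ℓ) * AW') * tS * rowConst261 (@geo9Y d ℓ hd hL b₀ b₁ Mstar) σ) * (((ℓ + 1 : ℕ) : ℝ)) * ((geo9Y x).M * α₀)) (ρ - τ) U := ⟨hS1a.mono hkS, hS1b.mono hkS⟩
  -- (3) ∇_UG₀T and (4) ∇_{U,ν}G₀T out of 𝔖₂, the latter also out of 𝔖₁
  have hD2 := stepDS_of_lettersS hG hrowx hc0 hB12₀ hB₃ ht hρ hρT hρ0 hρ3 (hθc B12₀ B₃ hB12₀ hB₃) le_rfl (he1 x hM0 α₀ hα ha U hU hU') (hdgDH x hM0 α₀ hα ha U hU hU') hLSx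
  have hθD0 : 0 ≤ 2 * ((B12₀ + (1 + CLip d ℓ) * B₃) * tS * rowConst261 (@geo9Y d ℓ hd hL b₀ b₁ Mstar) σ) * ((geo9Y x).M * α₀) := by positivity
  have hDd2 : ∀ ν : Fin (d + 1), _ := fun ν => stepDdS_of_lettersS hG hrowx hc0 hB12₀ hB₃ ht hρ hρT hρ0 hρ3 (hθc B12₀ B₃ hB12₀ hB₃) le_rfl (he1d x hM0 α₀ hα ha U hU hU') (hdgDHd x hM0 α₀ hα ha U hU hU') hLSx ν
  have hDd1 : ∀ ν : Fin (d + 1),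
      HasMaj (bXH x U) (cNormR 1 (H x) (𝔬12 x).blk hG.lenle 0) (Dd x U ν ∘ₗ (𝔬12 x).G0 U ∘ₗ (𝔬12 x).Tpi U) (fun a b => 2 * ((B12₀ + (1 + CLip d ℓ) * B₃) * tS * rowConst261 (@geo9Y d ℓ hd hL b₀ b₁ Mstar) σ) * ((geo9Y x).M * α₀) * (geo9Y x).L * Real.exp (-((ρ - τ) * (geo9Y x).dist a b))) ∧
      HasMaj (bXH x U) (cNormR 1 (H x) (𝔬12 x).blk hG.lenle 0) (Dd x U ν ∘ₗ (𝔬12 x).G0 U ∘ₗ ((𝔬12 x).Tpi U + (𝔬12 x).T2 U)) (fun a b => 2 * ((B12₀ + (1 + CLip d ℓ) * B₃) * tS * rowConst261 (@geo9Y d ℓ hd hL b₀ b₁ Mstar) σ) * ((geo9Y x).M * α₀) * (geo9Y x).L * Real.exp (-((ρ - τ) * (geo9Y x).dist a b))) := by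
    intro ν
    have hA := fieldS_up hG hFax hθD0 (hasMaj_toR_tgt hG (hDd2 ν).1)
    have hB := fieldS_up hG hFax hθD0 (hasMaj_toR_tgt hG (hDd2 ν).2)
    rw [hτe, Nat.cast_one, show (-1 : ℝ) + 1 = 0 by norm_num] at hA hB
    exact ⟨hA, hB⟩
  -- (5) the Φ^Y probes out of 𝔖₂; (6) the Φ^X probes of the component derivatives out of 𝔖₂ and 𝔖₁
  have hY2 : ∀ β : ℝ, 0 ≤ β → β < 1 → _ := fun β hb0 hb1 =>
    probeYS_of_lettersS hG hrowx hc0 (hBh12 β hb0 hb1) (hBhD β hb0 hb1) ht hρ hρT hρ0 hρ3 (hθc (Bh12 β) (BhD β) (hBh12 β hb0 hb1) (hBhD β hb0 hb1)) le_rfl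
      (h43L x hM0 α₀ hα ha U hU hU' β hb0 hb1) (hYd x hM0 α₀ hα ha U hU hU' β hb0 hb1) hLSx
  have hXd2 : ∀ (ν : Fin (d + 1)) (β : ℝ), 0 ≤ β → β < 1 → _ := fun ν β hb0 hb1 =>
    probeXdS_of_lettersS hG hrowx hc0 (hBh12 β hb0 hb1) (hBdX β hb0 hb1) ht hρ hρT hρ0 hρ3 (hθc (Bh12 β) (BdX β) (hBh12 β hb0 hb1) (hBdX β hb0 hb1)) le_rfl ν
      (h43d x hM0 α₀ hα ha U hU hU' ν β hb0 hb1) (hXd x hM0 α₀ hα ha U hU hU' ν β hb0 hb1) hLSx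
  have hXd1 : ∀ (ν : Fin (d + 1)) (β : ℝ), 0 ≤ β → β < 1 →
      HasMaj (bXH x U) (cNormR 1 (H x) (𝔭A x).blkPX hG.lenle β) (((𝔭A x).ΦX U β ∘ₗ Dd x U ν ∘ₗ (𝔬12 x).G0 U) ∘ₗ (𝔬12 x).Tpi U) (fun a b => 2 * ((Bh12 β + (1 + CLip d ℓ) * BdX β) * tS * rowConst261 (@geo9Y d ℓ hd hL b₀ b₁ Mstar) σ) * ((geo9Y x).M * α₀) * (geo9Y x).L * Real.exp (-((ρ - τ) * (geo9Y x).dist a b))) ∧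
      HasMaj (bXH x U) (cNormR 1 (H x) (𝔭A x).blkPX hG.lenle β) (((𝔭A x).ΦX U β ∘ₗ Dd x U ν ∘ₗ (𝔬12 x).G0 U) ∘ₗ ((𝔬12 x).Tpi U + (𝔬12 x).T2 U)) (fun a b => 2 * ((Bh12 β + (1 + CLip d ℓ) * BdX β) * tS * rowConst261 (@geo9Y d ℓ hd hL b₀ b₁ Mstar) σ) * ((geo9Y x).M * α₀) * (geo9Y x).L * Real.exp (-((ρ - τ) * (geo9Y x).dist a b))) := by
    intro ν β hb0 hb1
    have h0 : 0 ≤ 2 * ((Bh12 β + (1 + CLip d ℓ) * BdX β) * tS * rowConst261 (@geo9Y d ℓ hd hL b₀ b₁ Mstar) σ) * ((geo9Y x).M * α₀) := by have := hBh12 β hb0 hb1; have := hBdX β hb0 hb1; positivity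
    have hA := fieldS_up hG hFax h0 (hXd2 ν β hb0 hb1).1
    have hB := fieldS_up hG hFax h0 (hXd2 ν β hb0 hb1).2
    rw [hτe, show β - 1 + 1 = β by ring] at hA hB
    exact ⟨hA, hB⟩
  -- (7) the Φ^X probes of the step itself: the displayed W-sup probe word moved to `bH13` (one power of `Lʲη`, then the (P2′) sup reading), out of 𝔖₂ and 𝔖₁
  have hid : HasMaj (bH13 x U) (cNorm 1 (H x) (𝔬12 x).blkW hG.lenle 1) LinearMap.id
      (fun a b => (w13 s44)⁻¹ * (((((ℓ + 1 : ℕ) : ℝ)) * Real.exp ((δ12₃ - τ) * (rNear d ℓ + 1))) * Real.exp (-((δ12₃ - τ) * (geo9Y x).dist a b)))) := by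
    rw [hbH13 x U, hblkW12 x]
    exact hasMaj_id_bHZPG_cNorm x.toKIdx (trBasis N) (taxiS x.toKIdx (bg9YR (Matrix (Fin N) (Fin N) ℂ) (specialUnitaryUnits (Fin N)) R₁ R₂ x) (fun U => U) U) w13 hw13₀ hw13₁
      hs440 hs441 hw1344 hG.lenle (hlev x) (by linarith) hNr hcf
  have hid' : HasMaj (bH13 x U) (cNormR 1 (H x) (𝔬12 x).blkW hG.lenle (-1)) LinearMap.id
      (fun a b => ((w13 s44)⁻¹ * ((((ℓ + 1 : ℕ) : ℝ)) * Real.exp ((δ12₃ - τ) * (rNear d ℓ + 1)))) * Real.exp (-((δ12₃ - τ) * (geo9Y x).dist a b))) := by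
    have h := hasMaj_toR_tgt hG hid
    rw [Nat.cast_one] at h
    exact h.mono fun a b => le_of_eq (by ring)
  have hX2 : ∀ β : ℝ, 0 ≤ β → β < 1 → _ := fun β hb0 hb1 => by
    have hDv := hasMaj_shift hG hFax (-1 : ℝ) (by norm_num) (hBx13 β hb0 hb1) (hpXDv x hM0 α₀ hα ha U hU hU' β hb0 hb1)
    rw [rpow_abs_eq_pow (geo9Y x).L (-1) 1 (by norm_num), pow_one, hτe, show (0 : ℝ) + -1 = -1 by norm_num, show β - 1 + -1 = β - 2 by ring] at hDv
    have hDv' : HasMaj (cNormR 1 (H x) (𝔬12 x).blkW hG.lenle (-1)) (cNormR 1 (H x) (𝔭A x).blkPX hG.lenle (β - 2)) (((𝔭A x).ΦX U β ∘ₗ (𝔬12 x).G0 U) ∘ₗ (𝔬12 x).Dv U)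
        (fun a b => Bx13 β * (((ℓ + 1 : ℕ) : ℝ)) * Real.exp (-((δ12₃ - τ) * (geo9Y x).dist a b))) :=
      hasMaj_weaken hG (by have := hBx13 β hb0 hb1; positivity) (mul_le_mul_of_nonneg_left hLx (hBx13 β hb0 hb1)) le_rfl hDv
    have hcomp := hasMaj_comp_exp htri hG.dnn hrowx (by have := hBx13 β hb0 hb1; positivity) (by have := hw13₀ s44; positivity) (show 0 ≤ δ12₃ - τ - σ by linarith)
      (by linarith) (by linarith) hDv' hid'
    rw [LinearMap.comp_id, cNormR_κ] at hcomp
    exact probeXS_of_lettersS hG hrowx hc0 hcX0 (by have := hBx13 β hb0 hb1; positivity) ht hρ hρT hρ0 (by linarith) (hθc cX0 _ hcX0 (by have := hBx13 β hb0 hb1; positivity)) le_rfl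
      (hpX0 x hM0 α₀ hα ha U hU hU' β hb0 hb1) hcomp hLSx
  have hX1 : ∀ β : ℝ, 0 ≤ β → β < 1 →
      HasMaj (bXH x U) (cNormR 1 (H x) (𝔭A x).blkPX hG.lenle (β - 1)) (((𝔭A x).ΦX U β ∘ₗ (𝔬12 x).G0 U) ∘ₗ (𝔬12 x).Tpi U) (fun a b => 2 * ((cX0 + (1 + CLip d ℓ) * (1 * (Bx13 β * (((ℓ + 1 : ℕ) : ℝ))) * ((w13 s44)⁻¹ * ((((ℓ + 1 : ℕ) : ℝ)) * Real.exp ((δ12₃ - τ) * (rNear d ℓ + 1)))) * rowConst261 (@geo9Y d ℓ hd hL b₀ b₁ Mstar) σ)) * tS * rowConst261 (@geo9Y d ℓ hd hL b₀ b₁ Mstar) σ) * ((geo9Y x).M * α₀) * (geo9Y x).L * Real.exp (-((ρ - τ) * (geo9Y x).dist a b))) ∧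
      HasMaj (bXH x U) (cNormR 1 (H x) (𝔭A x).blkPX hG.lenle (β - 1)) (((𝔭A x).ΦX U β ∘ₗ (𝔬12 x).G0 U) ∘ₗ ((𝔬12 x).Tpi U + (𝔬12 x).T2 U)) (fun a b => 2 * ((cX0 + (1 + CLip d ℓ) * (1 * (Bx13 β * (((ℓ + 1 : ℕ) : ℝ))) * ((w13 s44)⁻¹ * ((((ℓ + 1 : ℕ) : ℝ)) * Real.exp ((δ12₃ - τ) * (rNear d ℓ + 1)))) * rowConst261 (@geo9Y d ℓ hd hL b₀ b₁ Mstar) σ)) * tS * rowConst261 (@geo9Y d ℓ hd hL b₀ b₁ Mstar) σ) * ((geo9Y x).M * α₀) * (geo9Y x).L * Real.exp (-((ρ - τ) * (geo9Y x).dist a b))) := by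
    intro β hb0 hb1
    have h0 : 0 ≤ 2 * ((cX0 + (1 + CLip d ℓ) * (1 * (Bx13 β * (((ℓ + 1 : ℕ) : ℝ))) * ((w13 s44)⁻¹ * ((((ℓ + 1 : ℕ) : ℝ)) * Real.exp ((δ12₃ - τ) * (rNear d ℓ + 1)))) * rowConst261 (@geo9Y d ℓ hd hL b₀ b₁ Mstar) σ)) * tS * rowConst261 (@geo9Y d ℓ hd hL b₀ b₁ Mstar) σ) * ((geo9Y x).M * α₀) := by
      have := hBx13 β hb0 hb1; have := hw13₀ s44; positivity
    have hA := fieldS_up hG hFax h0 (hX2 β hb0 hb1).1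
    have hB := fieldS_up hG hFax h0 (hX2 β hb0 hb1).2
    rw [hτe, show β - 2 + 1 = β - 1 by ring] at hA hB
    exact ⟨hA, hB⟩
  exact ⟨hS2, hS1, hD2, fun ν => ⟨hDd2 ν, hDd1 ν⟩, hY2, fun ν β hb0 hb1 => ⟨hXd2 ν β hb0 hb1, hXd1 ν β hb0 hb1⟩, fun β hb0 hb1 => ⟨hX2 β hb0 hb1, hX1 β hb0 hb1⟩⟩

end Summit.QuantumFields.YangMills.BalabanUVNodes.N06StatePairsAtPinsPU

end
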